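import Mathlib
import HarnessLib
import HarnessLib.Audit
import Summits.Langlands.Statement
import Summits.Langlands.Langlands.Theses.SkinnerWilesDefectOne
import Literature.NumberTheory.Automorphic.AutomorphicInductionCharacter
import Literature.NumberTheory.Automorphic.ReciprocityGLn
import Literature.NumberTheory.GaloisRepresentations.OrdinaryGaloisRep
import Literature.NumberTheory.GaloisRepresentations.GaloisRep
import Literature.NumberTheory.GaloisRepresentations.HeckeCharacter
import Literature.FieldTheory.AlgClosed.PadicAlgClEquivComplex

/-!
# SkinnerWilesDefectOneSymmetryType — the symmetry-type trichotomy of the Skinner–Wiles blocker (tree twin, Part A, of the decomp-langlands lens-2 g18 node `SymmetryTypeSplit`)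

Theorems-side twin of the node `run/shared/lean/pub/decomp-langlands/nodes/lens-2-g18-SymmetryTypeSplit.lean` (0 sorry), landed so that the CELLS and the DIAL are
citable BY NAME before / independently of the child route `SymmetryTypeSplit` (refines route-Langlands-SkinnerWilesDefectOne:ReducibleOrdinaryProModular, stmt-Langlands-12919).
Content (statements VERBATIM = node = route items; one generator `texts18.py`): §1 the dial `IsSelfTwist` / `IsOddDescent` / `IsEvenDescent` on framed
ρ : Γ_F → GL₂(ℚ̄_p) with the certificates `selfTwist_sq_eq_one`, `isOddDescent_of_restrictField`, `dial_trichotomy`; §2 the cells — the host blocker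
E = `SkinnerWilesDefectOne.ReducibleOrdinaryProModular` (12919) and target X = `…ReducibleOrdinaryModular` (12918) VERBATIM with the sector hypotheses inserted
(CM | odd descent | generic, and generic = even descent | primitive), plus the layer-2 stub statements as `Prop`s; §3 `Iff.rfl` text identities with the host decls;
§4 kernels: exactness `engine_iff_cells` / `target_iff_cells` (mod nothing), `closes_engine` / `closes_target` / `closes_root` (the node's `closes`, renamed: a helper file may not declare `closes`) / `closes_via_host`, necessity, the level
square under the host EXIT and the dictionary, and the parity layer of the generic cell.  Part B (`SkinnerWilesDefectOneSymmetryTypeStubs`) holds the stub compositions.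
No new Literature facts; no instances, notation or attributes.
-/

set_option linter.dupNamespace false
set_option linter.unusedVariables false

namespace Summit.Langlands.Langlands.Theorems.SkinnerWilesDefectOneSymmetryType

open scoped NumberField
open Filter Field IsDedekindDomain
open Literature.NumberTheory.GaloisRepresentations Literature.NumberTheory.Automorphic

/-! ## §1 The dial (structured vocabulary; the items inline these texts VERBATIM — bridges `…_iff_text` are `Iff.rfl`) -/

section Dial
variable (F : Type) [Field F] [NumberField F] (p : ℕ) [Fact p.Prime]

/-- **CM / self-twist**: `η ⊗ ρ ≅ ρ` for a continuous character `η ≠ 1` of `Γ_F` (`P` the intertwiner). -/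
def IsSelfTwist (ρ : FramedGaloisRep F (PadicAlgCl p) 2) : Prop :=
  (∃ (η : Field.absoluteGaloisGroup F →ₜ* (PadicAlgCl p)ˣ) (P : Matrix.GeneralLinearGroup (Fin 2) (PadicAlgCl p)), (∃ σ : Field.absoluteGaloisGroup F, η σ ≠ 1) ∧ ∀ σ : Field.absoluteGaloisGroup F, ((η σ : (PadicAlgCl p)ˣ) : PadicAlgCl p) • (ρ σ).val = (P * ρ σ * P⁻¹).val)

/-- **odd twisted descent**: `ρ = ν ⊗ ρ'|_{Γ_F}` pointwise for an ODD `ρ' : Γ_ℚ → GL₂(ℚ̄_p)` and a finite-order continuous `ν`. -/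
def IsOddDescent (ρ : FramedGaloisRep F (PadicAlgCl p) 2) : Prop :=
  (∃ (ρ' : Literature.NumberTheory.GaloisRepresentations.FramedGaloisRep ℚ (PadicAlgCl p) 2) (ν : Field.absoluteGaloisGroup F →ₜ* (PadicAlgCl p)ˣ), ρ'.IsOdd ∧ (∃ n : ℕ, 0 < n ∧ ∀ σ, ν σ ^ n = 1) ∧ ∀ σ : Field.absoluteGaloisGroup F, (ρ σ).val = ((ν σ : (PadicAlgCl p)ˣ) : PadicAlgCl p) • (ρ' (Literature.NumberTheory.GaloisRepresentations.absGaloisRestrict ℚ F σ)).val)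

/-- **even twisted descent**: the same with `ρ'` NOT odd (`det ρ'(c) = +1`). -/
def IsEvenDescent (ρ : FramedGaloisRep F (PadicAlgCl p) 2) : Prop :=
  (∃ (ρ' : Literature.NumberTheory.GaloisRepresentations.FramedGaloisRep ℚ (PadicAlgCl p) 2) (ν : Field.absoluteGaloisGroup F →ₜ* (PadicAlgCl p)ˣ), ¬ ρ'.IsOdd ∧ (∃ n : ℕ, 0 < n ∧ ∀ σ, ν σ ^ n = 1) ∧ ∀ σ : Field.absoluteGaloisGroup F, (ρ σ).val = ((ν σ : (PadicAlgCl p)ˣ) : PadicAlgCl p) • (ρ' (Literature.NumberTheory.GaloisRepresentations.absGaloisRestrict ℚ F σ)).val)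

variable {F p}

omit [NumberField F] in
/-- The self-twist character is quadratic: `η(σ)² = 1` (determinants; so `η` cuts out a quadratic `K/F`). -/
theorem selfTwist_sq_eq_one (ρ : FramedGaloisRep F (PadicAlgCl p) 2)
    (η : Field.absoluteGaloisGroup F →ₜ* (PadicAlgCl p)ˣ) (P : Matrix.GeneralLinearGroup (Fin 2) (PadicAlgCl p))
    (h : ∀ σ : Field.absoluteGaloisGroup F, ((η σ : (PadicAlgCl p)ˣ) : PadicAlgCl p) • (ρ σ).val = (P * ρ σ * P⁻¹).val)
    (σ : Field.absoluteGaloisGroup F) : ((η σ : (PadicAlgCl p)ˣ) : PadicAlgCl p) ^ 2 = 1 := by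
  have h1 := congrArg Matrix.det (h σ)
  rw [Matrix.det_smul, Fintype.card_fin] at h1
  have h2 : Matrix.det (P * ρ σ * P⁻¹).val = Matrix.det (ρ σ).val := by
    rw [← Matrix.GeneralLinearGroup.val_det_apply, ← Matrix.GeneralLinearGroup.val_det_apply, map_mul, map_mul, map_inv,
      mul_inv_cancel_comm]
  rw [h2] at h1
  have h3 : Matrix.det (ρ σ).val ≠ 0 := by
    rw [← Matrix.GeneralLinearGroup.val_det_apply]; exact (Units.isUnit _).ne_zero
  exact (mul_eq_right₀ h3).mp h1

/-- A base change of an odd `ρ'` lies in the odd-descent stratum (`ν = 1`): the shape of the route's non-vacuity witness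
`V₅(11a1)|_{Γ_{ℚ(√-2)}}` (11a1 is an odd, ordinary-at-5, residually reducible, 5-distinguished newform representation). -/
theorem isOddDescent_of_restrictField (ρ' : FramedGaloisRep ℚ (PadicAlgCl p) 2) (hodd : ρ'.IsOdd) :
    IsOddDescent F p (FramedGaloisRep.restrictField F ρ') :=
  ⟨ρ', 1, hodd, ⟨1, one_pos, fun σ => by simp⟩, fun σ => by
    rw [FramedGaloisRep.restrictField_apply]; simp⟩

/-- The strata exhaust (excluded middle twice). -/
theorem dial_trichotomy (ρ : FramedGaloisRep F (PadicAlgCl p) 2) :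
    IsSelfTwist F p ρ ∨ (¬ IsSelfTwist F p ρ ∧ IsOddDescent F p ρ) ∨ (¬ IsSelfTwist F p ρ ∧ ¬ IsOddDescent F p ρ) := by
  by_cases h1 : IsSelfTwist F p ρ
  · exact Or.inl h1
  · by_cases h2 : IsOddDescent F p ρ
    · exact Or.inr (Or.inl ⟨h1, h2⟩)
    · exact Or.inr (Or.inr ⟨h1, h2⟩)

/-- Layer 2 of the generic stratum exhausts it (excluded middle on even descent). -/
theorem generic_dichotomy (ρ : FramedGaloisRep F (PadicAlgCl p) 2) (h1 : ¬ IsSelfTwist F p ρ) (h2 : ¬ IsOddDescent F p ρ) :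
    (¬ IsSelfTwist F p ρ ∧ ¬ IsOddDescent F p ρ ∧ IsEvenDescent F p ρ) ∨
    (¬ IsSelfTwist F p ρ ∧ ¬ IsOddDescent F p ρ ∧ ¬ IsEvenDescent F p ρ) := by
  by_cases h3 : IsEvenDescent F p ρ
  · exact Or.inl ⟨h1, h2, h3⟩
  · exact Or.inr ⟨h1, h2, h3⟩

end Dial

/-! ## §2 The cells (texts = the host items VERBATIM + the sector hypotheses; items of the child routes) -/

/-- **CM cell of the target** (X on the self-twist stratum): WEAKER, ATTACKABLE-NOW (automorphic induction). -/
def CMModular : Prop :=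
  ∀ (F : Type) [Field F] [NumberField F], NumberField.IsTotallyComplex F → Module.finrank ℚ F = 2 → ∀ (p : ℕ) [Fact p.Prime], p ≠ 2 → ∀ (O : ValuationSubring (PadicAlgCl p)), O = (Valued.v : Valuation (PadicAlgCl p) NNReal).valuationSubring → ∀ (hcpt : Literature.NumberTheory.Automorphic.isCompact_glFiniteIntegralLevel 2 F) (ι : PadicAlgCl p ≃+* ℂ) (ρ : Literature.NumberTheory.GaloisRepresentations.FramedGaloisRep F (PadicAlgCl p) 2) (ρ₀ : Field.absoluteGaloisGroup F →* Matrix.GeneralLinearGroup (Fin 2) O), ρ.toGaloisRep.IsIrreducible → (∀ᶠ v in cofinite, ρ.IsUnramifiedAt v) → ρ.HasUpperTriangularIntegralModel ρ₀ → (∃ k : ℕ, 2 ≤ k ∧ ∃ m : ℕ, 0 < m ∧ ∀ v : IsDedekindDomain.HeightOneSpectrum (NumberField.RingOfIntegers F), (p : NumberField.RingOfIntegers F) ∈ v.asIdeal → Literature.NumberTheory.GaloisRepresentations.IsPDistinguishedAt ρ₀ v ∧ ∃ Q : Matrix.GeneralLinearGroup (Fin 2) (PadicAlgCl p), Valued.v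 (Q.val 0 0) ≤ Valued.v (Q.val 1 0) ∧ ∀ σ, (Q⁻¹ * ρ.toLocal v σ * Q).val 1 0 = 0 ∧ (σ ∈ Literature.NumberTheory.GaloisRepresentations.absInertia (v.adicCompletion F) → (Q⁻¹ * ρ.toLocal v σ * Q).val 1 1 ^ m = 1 ∧ (Q⁻¹ * ρ.toLocal v σ * Q).val 0 0 ^ m = algebraMap (Padic p) (PadicAlgCl p) (((Literature.NumberTheory.GaloisRepresentations.GaloisRep.cyclotomicCharacter (v.adicCompletion F) p σ).val : PadicInt p) : Padic p) ^ ((k - 1) * m))) → (∃ (η : Field.absoluteGaloisGroup F →ₜ* (PadicAlgCl p)ˣ) (P : Matrix.GeneralLinearGroup (Fin 2) (PadicAlgCl p)), (∃ σ : Field.absoluteGaloisGroup F, η σ ≠ 1) ∧ ∀ σ : Field.absoluteGaloisGroup F, ((η σ : (PadicAlgCl p)ˣ) : PadicAlgCl p) • (ρ σ).val = (P * ρ σ * P⁻¹).val) → ∃ π : Literature.NumberTheory.Automorphic.CuspidalAutomorphicRepData 2 F hcpt, π.1.IsLAlgebraic ∧ ∀ᶠ v in cofinite, Summit.Langlands.SatakeFrobCompatibleAt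 ι π.1 ρ v

/-- **Odd-descent cell of the target** (X on the non-CM odd-twisted-descent stratum): WEAKER, ATTACKABLE-NOW (Skinner–Wiles over ℚ + Langlands
base change + twist); contains the route witness. -/
def OddDescentModular : Prop :=
  ∀ (F : Type) [Field F] [NumberField F], NumberField.IsTotallyComplex F → Module.finrank ℚ F = 2 → ∀ (p : ℕ) [Fact p.Prime], p ≠ 2 → ∀ (O : ValuationSubring (PadicAlgCl p)), O = (Valued.v : Valuation (PadicAlgCl p) NNReal).valuationSubring → ∀ (hcpt : Literature.NumberTheory.Automorphic.isCompact_glFiniteIntegralLevel 2 F) (ι : PadicAlgCl p ≃+* ℂ) (ρ : Literature.NumberTheory.GaloisRepresentations.FramedGaloisRep F (PadicAlgCl p) 2) (ρ₀ : Field.absoluteGaloisGroup F →* Matrix.GeneralLinearGroup (Fin 2) O), ρ.toGaloisRep.IsIrreducible → (∀ᶠ v in cofinite, ρ.IsUnramifiedAt v) → ρ.HasUpperTriangularIntegralModel ρ₀ → (∃ k : ℕ, 2 ≤ k ∧ ∃ m : ℕ, 0 < m ∧ ∀ v : IsDedekindDomain.HeightOneSpectrum (NumberField.RingOfIntegers F),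 (p : NumberField.RingOfIntegers F) ∈ v.asIdeal → Literature.NumberTheory.GaloisRepresentations.IsPDistinguishedAt ρ₀ v ∧ ∃ Q : Matrix.GeneralLinearGroup (Fin 2) (PadicAlgCl p), Valued.v (Q.val 0 0) ≤ Valued.v (Q.val 1 0) ∧ ∀ σ, (Q⁻¹ * ρ.toLocal v σ * Q).val 1 0 = 0 ∧ (σ ∈ Literature.NumberTheory.GaloisRepresentations.absInertia (v.adicCompletion F) → (Q⁻¹ * ρ.toLocal v σ * Q).val 1 1 ^ m = 1 ∧ (Q⁻¹ * ρ.toLocal v σ * Q).val 0 0 ^ m = algebraMap (Padic p) (PadicAlgCl p) (((Literature.NumberTheory.GaloisRepresentations.GaloisRep.cyclotomicCharacter (v.adicCompletion F) p σ).val : PadicInt p) : Padic p) ^ ((k - 1) * m))) → ¬ (∃ (η : Field.absoluteGaloisGroup F →ₜ* (PadicAlgCl p)ˣ) (P : Matrix.GeneralLinearGroup (Fin 2) (PadicAlgCl p)), (∃ σ : Field.absoluteGaloisGroup F, η σ ≠ 1) ∧ ∀ σ : Field.absoluteGaloisGroup F, ((η σ : (PadicAlgCl p)ˣ) : PadicAlgCl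 p) • (ρ σ).val = (P * ρ σ * P⁻¹).val) → (∃ (ρ' : Literature.NumberTheory.GaloisRepresentations.FramedGaloisRep ℚ (PadicAlgCl p) 2) (ν : Field.absoluteGaloisGroup F →ₜ* (PadicAlgCl p)ˣ), ρ'.IsOdd ∧ (∃ n : ℕ, 0 < n ∧ ∀ σ, ν σ ^ n = 1) ∧ ∀ σ : Field.absoluteGaloisGroup F, (ρ σ).val = ((ν σ : (PadicAlgCl p)ˣ) : PadicAlgCl p) • (ρ' (Literature.NumberTheory.GaloisRepresentations.absGaloisRestrict ℚ F σ)).val) → ∃ π : Literature.NumberTheory.Automorphic.CuspidalAutomorphicRepData 2 F hcpt, π.1.IsLAlgebraic ∧ ∀ᶠ v in cofinite, Summit.Langlands.SatakeFrobCompatibleAt ι π.1 ρ v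

/-- **Generic cell of the target** (X on the stratum with no self-twist and no odd descent): WEAKER, residual (⟸ `GenericProModular ∧ EXIT`). -/
def GenericModular : Prop :=
  ∀ (F : Type) [Field F] [NumberField F], NumberField.IsTotallyComplex F → Module.finrank ℚ F = 2 → ∀ (p : ℕ) [Fact p.Prime], p ≠ 2 → ∀ (O : ValuationSubring (PadicAlgCl p)), O = (Valued.v : Valuation (PadicAlgCl p) NNReal).valuationSubring → ∀ (hcpt : Literature.NumberTheory.Automorphic.isCompact_glFiniteIntegralLevel 2 F) (ι : PadicAlgCl p ≃+* ℂ) (ρ : Literature.NumberTheory.GaloisRepresentations.FramedGaloisRep F (PadicAlgCl p) 2) (ρ₀ : Field.absoluteGaloisGroup F →* Matrix.GeneralLinearGroup (Fin 2) O), ρ.toGaloisRep.IsIrreducible → (∀ᶠ v in cofinite, ρ.IsUnramifiedAt v) → ρ.HasUpperTriangularIntegralModel ρ₀ → (∃ k : ℕ, 2 ≤ k ∧ ∃ m : ℕ, 0 < m ∧ ∀ v : IsDedekindDomain.HeightOneSpectrum (NumberField.RingOfIntegers F), (p : NumberField.RingOfIntegers F) ∈ v.asIdeal → Literature.NumberTheory.GaloisRepresentations.IsPDistinguishedAt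 ρ₀ v ∧ ∃ Q : Matrix.GeneralLinearGroup (Fin 2) (PadicAlgCl p), Valued.v (Q.val 0 0) ≤ Valued.v (Q.val 1 0) ∧ ∀ σ, (Q⁻¹ * ρ.toLocal v σ * Q).val 1 0 = 0 ∧ (σ ∈ Literature.NumberTheory.GaloisRepresentations.absInertia (v.adicCompletion F) → (Q⁻¹ * ρ.toLocal v σ * Q).val 1 1 ^ m = 1 ∧ (Q⁻¹ * ρ.toLocal v σ * Q).val 0 0 ^ m = algebraMap (Padic p) (PadicAlgCl p) (((Literature.NumberTheory.GaloisRepresentations.GaloisRep.cyclotomicCharacter (v.adicCompletion F) p σ).val : PadicInt p) : Padic p) ^ ((k - 1) * m))) → ¬ (∃ (η : Field.absoluteGaloisGroup F →ₜ* (PadicAlgCl p)ˣ) (P : Matrix.GeneralLinearGroup (Fin 2) (PadicAlgCl p)), (∃ σ : Field.absoluteGaloisGroup F, η σ ≠ 1) ∧ ∀ σ : Field.absoluteGaloisGroup F, ((η σ : (PadicAlgCl p)ˣ) : PadicAlgCl p) • (ρ σ).val = (P * ρ σ * P⁻¹).val) → ¬ (∃ (ρ' : Literature.NumberTheory.GaloisRepresentations.FramedGaloisRep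 ℚ (PadicAlgCl p) 2) (ν : Field.absoluteGaloisGroup F →ₜ* (PadicAlgCl p)ˣ), ρ'.IsOdd ∧ (∃ n : ℕ, 0 < n ∧ ∀ σ, ν σ ^ n = 1) ∧ ∀ σ : Field.absoluteGaloisGroup F, (ρ σ).val = ((ν σ : (PadicAlgCl p)ˣ) : PadicAlgCl p) • (ρ' (Literature.NumberTheory.GaloisRepresentations.absGaloisRestrict ℚ F σ)).val) → ∃ π : Literature.NumberTheory.Automorphic.CuspidalAutomorphicRepData 2 F hcpt, π.1.IsLAlgebraic ∧ ∀ᶠ v in cofinite, Summit.Langlands.SatakeFrobCompatibleAt ι π.1 ρ v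

/-- **CM cell of the engine** (E on the self-twist stratum): WEAKER, ATTACKABLE-NOW modulo the dictionary `ClassicalOrdinaryProModular`. -/
def CMProModular : Prop :=
  ∀ (F : Type) [Field F] [NumberField F], NumberField.IsTotallyComplex F → Module.finrank ℚ F = 2 → ∀ (p : ℕ) [Fact p.Prime], p ≠ 2 → ∀ (O : ValuationSubring (PadicAlgCl p)), O = (Valued.v : Valuation (PadicAlgCl p) NNReal).valuationSubring → ∀ (ρ : Literature.NumberTheory.GaloisRepresentations.FramedGaloisRep F (PadicAlgCl p) 2) (ρ₀ : Field.absoluteGaloisGroup F →* Matrix.GeneralLinearGroup (Fin 2) O), ρ.toGaloisRep.IsIrreducible → (∀ᶠ v in cofinite, ρ.IsUnramifiedAt v) → ρ.HasUpperTriangularIntegralModel ρ₀ → (∃ k : ℕ, 2 ≤ k ∧ ∃ m : ℕ, 0 < m ∧ ∀ v : IsDedekindDomain.HeightOneSpectrum (NumberField.RingOfIntegers F), (p : NumberField.RingOfIntegers F) ∈ v.asIdeal → Literature.NumberTheory.GaloisRepresentations.IsPDistinguishedAt ρ₀ v ∧ ∃ Q : Matrix.GeneralLinearGroup (Fin 2)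 (PadicAlgCl p), Valued.v (Q.val 0 0) ≤ Valued.v (Q.val 1 0) ∧ ∀ σ, (Q⁻¹ * ρ.toLocal v σ * Q).val 1 0 = 0 ∧ (σ ∈ Literature.NumberTheory.GaloisRepresentations.absInertia (v.adicCompletion F) → (Q⁻¹ * ρ.toLocal v σ * Q).val 1 1 ^ m = 1 ∧ (Q⁻¹ * ρ.toLocal v σ * Q).val 0 0 ^ m = algebraMap (Padic p) (PadicAlgCl p) (((Literature.NumberTheory.GaloisRepresentations.GaloisRep.cyclotomicCharacter (v.adicCompletion F) p σ).val : PadicInt p) : Padic p) ^ ((k - 1) * m))) → (∃ (η : Field.absoluteGaloisGroup F →ₜ* (PadicAlgCl p)ˣ) (P : Matrix.GeneralLinearGroup (Fin 2) (PadicAlgCl p)), (∃ σ : Field.absoluteGaloisGroup F, η σ ≠ 1) ∧ ∀ σ : Field.absoluteGaloisGroup F, ((η σ : (PadicAlgCl p)ˣ) : PadicAlgCl p) • (ρ σ).val = (P * ρ σ * P⁻¹).val) → ∃ 𝒰 : Literature.NumberTheory.Automorphic.BigHeckeGLn.TameLevel 2 F p, 𝒰.IsPadicallyAutomorphic ρ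

/-- **Odd-descent cell of the engine**: WEAKER, ATTACKABLE-NOW modulo the dictionary. -/
def OddDescentProModular : Prop :=
  ∀ (F : Type) [Field F] [NumberField F], NumberField.IsTotallyComplex F → Module.finrank ℚ F = 2 → ∀ (p : ℕ) [Fact p.Prime], p ≠ 2 → ∀ (O : ValuationSubring (PadicAlgCl p)), O = (Valued.v : Valuation (PadicAlgCl p) NNReal).valuationSubring → ∀ (ρ : Literature.NumberTheory.GaloisRepresentations.FramedGaloisRep F (PadicAlgCl p) 2) (ρ₀ : Field.absoluteGaloisGroup F →* Matrix.GeneralLinearGroup (Fin 2) O), ρ.toGaloisRep.IsIrreducible → (∀ᶠ v in cofinite, ρ.IsUnramifiedAt v) → ρ.HasUpperTriangularIntegralModel ρ₀ → (∃ k : ℕ, 2 ≤ k ∧ ∃ m : ℕ, 0 < m ∧ ∀ v : IsDedekindDomain.HeightOneSpectrum (NumberField.RingOfIntegers F), (p : NumberField.RingOfIntegers F) ∈ v.asIdeal → Literature.NumberTheory.GaloisRepresentations.IsPDistinguishedAt ρ₀ v ∧ ∃ Q : Matrix.GeneralLinearGroup (Fin 2) (PadicAlgCl p), Valued.v (Q.val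 0 0) ≤ Valued.v (Q.val 1 0) ∧ ∀ σ, (Q⁻¹ * ρ.toLocal v σ * Q).val 1 0 = 0 ∧ (σ ∈ Literature.NumberTheory.GaloisRepresentations.absInertia (v.adicCompletion F) → (Q⁻¹ * ρ.toLocal v σ * Q).val 1 1 ^ m = 1 ∧ (Q⁻¹ * ρ.toLocal v σ * Q).val 0 0 ^ m = algebraMap (Padic p) (PadicAlgCl p) (((Literature.NumberTheory.GaloisRepresentations.GaloisRep.cyclotomicCharacter (v.adicCompletion F) p σ).val : PadicInt p) : Padic p) ^ ((k - 1) * m))) → ¬ (∃ (η : Field.absoluteGaloisGroup F →ₜ* (PadicAlgCl p)ˣ) (P : Matrix.GeneralLinearGroup (Fin 2) (PadicAlgCl p)), (∃ σ : Field.absoluteGaloisGroup F, η σ ≠ 1) ∧ ∀ σ : Field.absoluteGaloisGroup F, ((η σ : (PadicAlgCl p)ˣ) : PadicAlgCl p) • (ρ σ).val = (P * ρ σ * P⁻¹).val) → (∃ (ρ' : Literature.NumberTheory.GaloisRepresentations.FramedGaloisRep ℚ (PadicAlgCl p) 2) (ν : Field.absoluteGaloisGroup F →ₜ* (PadicAlgCl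 p)ˣ), ρ'.IsOdd ∧ (∃ n : ℕ, 0 < n ∧ ∀ σ, ν σ ^ n = 1) ∧ ∀ σ : Field.absoluteGaloisGroup F, (ρ σ).val = ((ν σ : (PadicAlgCl p)ˣ) : PadicAlgCl p) • (ρ' (Literature.NumberTheory.GaloisRepresentations.absGaloisRestrict ℚ F σ)).val) → ∃ 𝒰 : Literature.NumberTheory.Automorphic.BigHeckeGLn.TameLevel 2 F p, 𝒰.IsPadicallyAutomorphic ρ

/-- **Generic cell of the engine** = THE RESIDUAL BLOCKER (IDEA-NEEDED: STRATEGY-CENSUS D1–D4 of stmt-Langlands-12919 apply verbatim). -/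
def GenericProModular : Prop :=
  ∀ (F : Type) [Field F] [NumberField F], NumberField.IsTotallyComplex F → Module.finrank ℚ F = 2 → ∀ (p : ℕ) [Fact p.Prime], p ≠ 2 → ∀ (O : ValuationSubring (PadicAlgCl p)), O = (Valued.v : Valuation (PadicAlgCl p) NNReal).valuationSubring → ∀ (ρ : Literature.NumberTheory.GaloisRepresentations.FramedGaloisRep F (PadicAlgCl p) 2) (ρ₀ : Field.absoluteGaloisGroup F →* Matrix.GeneralLinearGroup (Fin 2) O), ρ.toGaloisRep.IsIrreducible → (∀ᶠ v in cofinite, ρ.IsUnramifiedAt v) → ρ.HasUpperTriangularIntegralModel ρ₀ → (∃ k : ℕ, 2 ≤ k ∧ ∃ m : ℕ, 0 < m ∧ ∀ v : IsDedekindDomain.HeightOneSpectrum (NumberField.RingOfIntegers F), (p : NumberField.RingOfIntegers F) ∈ v.asIdeal → Literature.NumberTheory.GaloisRepresentations.IsPDistinguishedAt ρ₀ v ∧ ∃ Q : Matrix.GeneralLinearGroup (Fin 2) (PadicAlgCl p), Valued.v (Q.val 0 0) ≤ Valued.v (Q.val 1 0) ∧ ∀ σ, (Q⁻¹ * ρ.toLocal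 v σ * Q).val 1 0 = 0 ∧ (σ ∈ Literature.NumberTheory.GaloisRepresentations.absInertia (v.adicCompletion F) → (Q⁻¹ * ρ.toLocal v σ * Q).val 1 1 ^ m = 1 ∧ (Q⁻¹ * ρ.toLocal v σ * Q).val 0 0 ^ m = algebraMap (Padic p) (PadicAlgCl p) (((Literature.NumberTheory.GaloisRepresentations.GaloisRep.cyclotomicCharacter (v.adicCompletion F) p σ).val : PadicInt p) : Padic p) ^ ((k - 1) * m))) → ¬ (∃ (η : Field.absoluteGaloisGroup F →ₜ* (PadicAlgCl p)ˣ) (P : Matrix.GeneralLinearGroup (Fin 2) (PadicAlgCl p)), (∃ σ : Field.absoluteGaloisGroup F, η σ ≠ 1) ∧ ∀ σ : Field.absoluteGaloisGroup F, ((η σ : (PadicAlgCl p)ˣ) : PadicAlgCl p) • (ρ σ).val = (P * ρ σ * P⁻¹).val) → ¬ (∃ (ρ' : Literature.NumberTheory.GaloisRepresentations.FramedGaloisRep ℚ (PadicAlgCl p) 2) (ν : Field.absoluteGaloisGroup F →ₜ* (PadicAlgCl p)ˣ), ρ'.IsOdd ∧ (∃ n : ℕ, 0 < n ∧ ∀ σ,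 ν σ ^ n = 1) ∧ ∀ σ : Field.absoluteGaloisGroup F, (ρ σ).val = ((ν σ : (PadicAlgCl p)ˣ) : PadicAlgCl p) • (ρ' (Literature.NumberTheory.GaloisRepresentations.absGaloisRestrict ℚ F σ)).val) → ∃ 𝒰 : Literature.NumberTheory.Automorphic.BigHeckeGLn.TameLevel 2 F p, 𝒰.IsPadicallyAutomorphic ρ

/-! ### Layer 2 of the generic cells (parity-blind descent dial) -/

/-- GEN ∩ even twisted descent, E-level: UNDECIDED / BARRIER leaf (even Fontaine–Mazur, residually reducible ordinary: no engine). -/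
def EvenDescentProModular : Prop :=
  ∀ (F : Type) [Field F] [NumberField F], NumberField.IsTotallyComplex F → Module.finrank ℚ F = 2 → ∀ (p : ℕ) [Fact p.Prime], p ≠ 2 → ∀ (O : ValuationSubring (PadicAlgCl p)), O = (Valued.v : Valuation (PadicAlgCl p) NNReal).valuationSubring → ∀ (ρ : Literature.NumberTheory.GaloisRepresentations.FramedGaloisRep F (PadicAlgCl p) 2) (ρ₀ : Field.absoluteGaloisGroup F →* Matrix.GeneralLinearGroup (Fin 2) O), ρ.toGaloisRep.IsIrreducible → (∀ᶠ v in cofinite, ρ.IsUnramifiedAt v) → ρ.HasUpperTriangularIntegralModel ρ₀ → (∃ k : ℕ, 2 ≤ k ∧ ∃ m : ℕ, 0 < m ∧ ∀ v : IsDedekindDomain.HeightOneSpectrum (NumberField.RingOfIntegers F), (p : NumberField.RingOfIntegers F) ∈ v.asIdeal → Literature.NumberTheory.GaloisRepresentations.IsPDistinguishedAt ρ₀ v ∧ ∃ Q : Matrix.GeneralLinearGroup (Fin 2) (PadicAlgCl p), Valued.v (Q.val 0 0) ≤ Valued.v (Q.val 1 0) ∧ ∀ σ, (Q⁻¹ *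 ρ.toLocal v σ * Q).val 1 0 = 0 ∧ (σ ∈ Literature.NumberTheory.GaloisRepresentations.absInertia (v.adicCompletion F) → (Q⁻¹ * ρ.toLocal v σ * Q).val 1 1 ^ m = 1 ∧ (Q⁻¹ * ρ.toLocal v σ * Q).val 0 0 ^ m = algebraMap (Padic p) (PadicAlgCl p) (((Literature.NumberTheory.GaloisRepresentations.GaloisRep.cyclotomicCharacter (v.adicCompletion F) p σ).val : PadicInt p) : Padic p) ^ ((k - 1) * m))) → ¬ (∃ (η : Field.absoluteGaloisGroup F →ₜ* (PadicAlgCl p)ˣ) (P : Matrix.GeneralLinearGroup (Fin 2) (PadicAlgCl p)), (∃ σ : Field.absoluteGaloisGroup F, η σ ≠ 1) ∧ ∀ σ : Field.absoluteGaloisGroup F, ((η σ : (PadicAlgCl p)ˣ) : PadicAlgCl p) • (ρ σ).val = (P * ρ σ * P⁻¹).val) → ¬ (∃ (ρ' : Literature.NumberTheory.GaloisRepresentations.FramedGaloisRep ℚ (PadicAlgCl p) 2) (ν : Field.absoluteGaloisGroup F →ₜ* (PadicAlgCl p)ˣ), ρ'.IsOdd ∧ (∃ n : ℕ, 0 < n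 ∧ ∀ σ, ν σ ^ n = 1) ∧ ∀ σ : Field.absoluteGaloisGroup F, (ρ σ).val = ((ν σ : (PadicAlgCl p)ˣ) : PadicAlgCl p) • (ρ' (Literature.NumberTheory.GaloisRepresentations.absGaloisRestrict ℚ F σ)).val) → (∃ (ρ' : Literature.NumberTheory.GaloisRepresentations.FramedGaloisRep ℚ (PadicAlgCl p) 2) (ν : Field.absoluteGaloisGroup F →ₜ* (PadicAlgCl p)ˣ), ¬ ρ'.IsOdd ∧ (∃ n : ℕ, 0 < n ∧ ∀ σ, ν σ ^ n = 1) ∧ ∀ σ : Field.absoluteGaloisGroup F, (ρ σ).val = ((ν σ : (PadicAlgCl p)ˣ) : PadicAlgCl p) • (ρ' (Literature.NumberTheory.GaloisRepresentations.absGaloisRestrict ℚ F σ)).val) → ∃ 𝒰 : Literature.NumberTheory.Automorphic.BigHeckeGLn.TameLevel 2 F p, 𝒰.IsPadicallyAutomorphic ρ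

/-- GEN with no twisted descent of either parity, E-level: IDEA-NEEDED proper (twist-primitive genuinely Bianchi ρ). -/
def PrimitiveProModular : Prop :=
  ∀ (F : Type) [Field F] [NumberField F], NumberField.IsTotallyComplex F → Module.finrank ℚ F = 2 → ∀ (p : ℕ) [Fact p.Prime], p ≠ 2 → ∀ (O : ValuationSubring (PadicAlgCl p)), O = (Valued.v : Valuation (PadicAlgCl p) NNReal).valuationSubring → ∀ (ρ : Literature.NumberTheory.GaloisRepresentations.FramedGaloisRep F (PadicAlgCl p) 2) (ρ₀ : Field.absoluteGaloisGroup F →* Matrix.GeneralLinearGroup (Fin 2) O), ρ.toGaloisRep.IsIrreducible → (∀ᶠ v in cofinite, ρ.IsUnramifiedAt v) → ρ.HasUpperTriangularIntegralModel ρ₀ → (∃ k : ℕ, 2 ≤ k ∧ ∃ m : ℕ, 0 < m ∧ ∀ v : IsDedekindDomain.HeightOneSpectrum (NumberField.RingOfIntegers F), (p : NumberField.RingOfIntegers F) ∈ v.asIdeal → Literature.NumberTheory.GaloisRepresentations.IsPDistinguishedAt ρ₀ v ∧ ∃ Q : Matrix.GeneralLinearGroup (Fin 2) (PadicAlgCl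 p), Valued.v (Q.val 0 0) ≤ Valued.v (Q.val 1 0) ∧ ∀ σ, (Q⁻¹ * ρ.toLocal v σ * Q).val 1 0 = 0 ∧ (σ ∈ Literature.NumberTheory.GaloisRepresentations.absInertia (v.adicCompletion F) → (Q⁻¹ * ρ.toLocal v σ * Q).val 1 1 ^ m = 1 ∧ (Q⁻¹ * ρ.toLocal v σ * Q).val 0 0 ^ m = algebraMap (Padic p) (PadicAlgCl p) (((Literature.NumberTheory.GaloisRepresentations.GaloisRep.cyclotomicCharacter (v.adicCompletion F) p σ).val : PadicInt p) : Padic p) ^ ((k - 1) * m))) → ¬ (∃ (η : Field.absoluteGaloisGroup F →ₜ* (PadicAlgCl p)ˣ) (P : Matrix.GeneralLinearGroup (Fin 2) (PadicAlgCl p)), (∃ σ : Field.absoluteGaloisGroup F, η σ ≠ 1) ∧ ∀ σ : Field.absoluteGaloisGroup F, ((η σ : (PadicAlgCl p)ˣ) : PadicAlgCl p) • (ρ σ).val = (P * ρ σ * P⁻¹).val) → ¬ (∃ (ρ' : Literature.NumberTheory.GaloisRepresentations.FramedGaloisRep ℚ (PadicAlgCl p) 2) (ν : Field.absoluteGaloisGroup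 F →ₜ* (PadicAlgCl p)ˣ), ρ'.IsOdd ∧ (∃ n : ℕ, 0 < n ∧ ∀ σ, ν σ ^ n = 1) ∧ ∀ σ : Field.absoluteGaloisGroup F, (ρ σ).val = ((ν σ : (PadicAlgCl p)ˣ) : PadicAlgCl p) • (ρ' (Literature.NumberTheory.GaloisRepresentations.absGaloisRestrict ℚ F σ)).val) → ¬ (∃ (ρ' : Literature.NumberTheory.GaloisRepresentations.FramedGaloisRep ℚ (PadicAlgCl p) 2) (ν : Field.absoluteGaloisGroup F →ₜ* (PadicAlgCl p)ˣ), ¬ ρ'.IsOdd ∧ (∃ n : ℕ, 0 < n ∧ ∀ σ, ν σ ^ n = 1) ∧ ∀ σ : Field.absoluteGaloisGroup F, (ρ σ).val = ((ν σ : (PadicAlgCl p)ˣ) : PadicAlgCl p) • (ρ' (Literature.NumberTheory.GaloisRepresentations.absGaloisRestrict ℚ F σ)).val) → ∃ 𝒰 : Literature.NumberTheory.Automorphic.BigHeckeGLn.TameLevel 2 F p, 𝒰.IsPadicallyAutomorphic ρ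

/-- GEN ∩ even twisted descent, X-level. -/
def EvenDescentModular : Prop :=
  ∀ (F : Type) [Field F] [NumberField F], NumberField.IsTotallyComplex F → Module.finrank ℚ F = 2 → ∀ (p : ℕ) [Fact p.Prime], p ≠ 2 → ∀ (O : ValuationSubring (PadicAlgCl p)), O = (Valued.v : Valuation (PadicAlgCl p) NNReal).valuationSubring → ∀ (hcpt : Literature.NumberTheory.Automorphic.isCompact_glFiniteIntegralLevel 2 F) (ι : PadicAlgCl p ≃+* ℂ) (ρ : Literature.NumberTheory.GaloisRepresentations.FramedGaloisRep F (PadicAlgCl p) 2) (ρ₀ : Field.absoluteGaloisGroup F →* Matrix.GeneralLinearGroup (Fin 2) O), ρ.toGaloisRep.IsIrreducible → (∀ᶠ v in cofinite, ρ.IsUnramifiedAt v) → ρ.HasUpperTriangularIntegralModel ρ₀ → (∃ k : ℕ, 2 ≤ k ∧ ∃ m : ℕ, 0 < m ∧ ∀ v : IsDedekindDomain.HeightOneSpectrum (NumberField.RingOfIntegers F), (p : NumberField.RingOfIntegers F) ∈ v.asIdeal → Literature.NumberTheory.GaloisRepresentations.IsPDistinguishedAt ρ₀ v ∧ ∃ Q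 : Matrix.GeneralLinearGroup (Fin 2) (PadicAlgCl p), Valued.v (Q.val 0 0) ≤ Valued.v (Q.val 1 0) ∧ ∀ σ, (Q⁻¹ * ρ.toLocal v σ * Q).val 1 0 = 0 ∧ (σ ∈ Literature.NumberTheory.GaloisRepresentations.absInertia (v.adicCompletion F) → (Q⁻¹ * ρ.toLocal v σ * Q).val 1 1 ^ m = 1 ∧ (Q⁻¹ * ρ.toLocal v σ * Q).val 0 0 ^ m = algebraMap (Padic p) (PadicAlgCl p) (((Literature.NumberTheory.GaloisRepresentations.GaloisRep.cyclotomicCharacter (v.adicCompletion F) p σ).val : PadicInt p) : Padic p) ^ ((k - 1) * m))) → ¬ (∃ (η : Field.absoluteGaloisGroup F →ₜ* (PadicAlgCl p)ˣ) (P : Matrix.GeneralLinearGroup (Fin 2) (PadicAlgCl p)), (∃ σ : Field.absoluteGaloisGroup F, η σ ≠ 1) ∧ ∀ σ : Field.absoluteGaloisGroup F, ((η σ : (PadicAlgCl p)ˣ) : PadicAlgCl p) • (ρ σ).val = (P * ρ σ * P⁻¹).val) → ¬ (∃ (ρ' : Literature.NumberTheory.GaloisRepresentations.FramedGaloisRep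 ℚ (PadicAlgCl p) 2) (ν : Field.absoluteGaloisGroup F →ₜ* (PadicAlgCl p)ˣ), ρ'.IsOdd ∧ (∃ n : ℕ, 0 < n ∧ ∀ σ, ν σ ^ n = 1) ∧ ∀ σ : Field.absoluteGaloisGroup F, (ρ σ).val = ((ν σ : (PadicAlgCl p)ˣ) : PadicAlgCl p) • (ρ' (Literature.NumberTheory.GaloisRepresentations.absGaloisRestrict ℚ F σ)).val) → (∃ (ρ' : Literature.NumberTheory.GaloisRepresentations.FramedGaloisRep ℚ (PadicAlgCl p) 2) (ν : Field.absoluteGaloisGroup F →ₜ* (PadicAlgCl p)ˣ), ¬ ρ'.IsOdd ∧ (∃ n : ℕ, 0 < n ∧ ∀ σ, ν σ ^ n = 1) ∧ ∀ σ : Field.absoluteGaloisGroup F, (ρ σ).val = ((ν σ : (PadicAlgCl p)ˣ) : PadicAlgCl p) • (ρ' (Literature.NumberTheory.GaloisRepresentations.absGaloisRestrict ℚ F σ)).val) → ∃ π : Literature.NumberTheory.Automorphic.CuspidalAutomorphicRepData 2 F hcpt, π.1.IsLAlgebraic ∧ ∀ᶠ v in cofinite, Summit.Langlands.SatakeFrobCompatibleAt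 ι π.1 ρ v

/-- GEN with no twisted descent of either parity, X-level. -/
def PrimitiveModular : Prop :=
  ∀ (F : Type) [Field F] [NumberField F], NumberField.IsTotallyComplex F → Module.finrank ℚ F = 2 → ∀ (p : ℕ) [Fact p.Prime], p ≠ 2 → ∀ (O : ValuationSubring (PadicAlgCl p)), O = (Valued.v : Valuation (PadicAlgCl p) NNReal).valuationSubring → ∀ (hcpt : Literature.NumberTheory.Automorphic.isCompact_glFiniteIntegralLevel 2 F) (ι : PadicAlgCl p ≃+* ℂ) (ρ : Literature.NumberTheory.GaloisRepresentations.FramedGaloisRep F (PadicAlgCl p) 2) (ρ₀ : Field.absoluteGaloisGroup F →* Matrix.GeneralLinearGroup (Fin 2) O), ρ.toGaloisRep.IsIrreducible → (∀ᶠ v in cofinite, ρ.IsUnramifiedAt v) → ρ.HasUpperTriangularIntegralModel ρ₀ → (∃ k : ℕ, 2 ≤ k ∧ ∃ m : ℕ, 0 < m ∧ ∀ v : IsDedekindDomain.HeightOneSpectrum (NumberField.RingOfIntegers F), (p : NumberField.RingOfIntegers F) ∈ v.asIdeal → Literature.NumberTheory.GaloisRepresentations.IsPDistinguishedAt ρ₀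 v ∧ ∃ Q : Matrix.GeneralLinearGroup (Fin 2) (PadicAlgCl p), Valued.v (Q.val 0 0) ≤ Valued.v (Q.val 1 0) ∧ ∀ σ, (Q⁻¹ * ρ.toLocal v σ * Q).val 1 0 = 0 ∧ (σ ∈ Literature.NumberTheory.GaloisRepresentations.absInertia (v.adicCompletion F) → (Q⁻¹ * ρ.toLocal v σ * Q).val 1 1 ^ m = 1 ∧ (Q⁻¹ * ρ.toLocal v σ * Q).val 0 0 ^ m = algebraMap (Padic p) (PadicAlgCl p) (((Literature.NumberTheory.GaloisRepresentations.GaloisRep.cyclotomicCharacter (v.adicCompletion F) p σ).val : PadicInt p) : Padic p) ^ ((k - 1) * m))) → ¬ (∃ (η : Field.absoluteGaloisGroup F →ₜ* (PadicAlgCl p)ˣ) (P : Matrix.GeneralLinearGroup (Fin 2) (PadicAlgCl p)), (∃ σ : Field.absoluteGaloisGroup F, η σ ≠ 1) ∧ ∀ σ : Field.absoluteGaloisGroup F, ((η σ : (PadicAlgCl p)ˣ) : PadicAlgCl p) • (ρ σ).val = (P * ρ σ * P⁻¹).val) → ¬ (∃ (ρ' : Literature.NumberTheory.GaloisRepresentations.FramedGaloisRep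 ℚ (PadicAlgCl p) 2) (ν : Field.absoluteGaloisGroup F →ₜ* (PadicAlgCl p)ˣ), ρ'.IsOdd ∧ (∃ n : ℕ, 0 < n ∧ ∀ σ, ν σ ^ n = 1) ∧ ∀ σ : Field.absoluteGaloisGroup F, (ρ σ).val = ((ν σ : (PadicAlgCl p)ˣ) : PadicAlgCl p) • (ρ' (Literature.NumberTheory.GaloisRepresentations.absGaloisRestrict ℚ F σ)).val) → ¬ (∃ (ρ' : Literature.NumberTheory.GaloisRepresentations.FramedGaloisRep ℚ (PadicAlgCl p) 2) (ν : Field.absoluteGaloisGroup F →ₜ* (PadicAlgCl p)ˣ), ¬ ρ'.IsOdd ∧ (∃ n : ℕ, 0 < n ∧ ∀ σ, ν σ ^ n = 1) ∧ ∀ σ : Field.absoluteGaloisGroup F, (ρ σ).val = ((ν σ : (PadicAlgCl p)ˣ) : PadicAlgCl p) • (ρ' (Literature.NumberTheory.GaloisRepresentations.absGaloisRestrict ℚ F σ)).val) → ∃ π : Literature.NumberTheory.Automorphic.CuspidalAutomorphicRepData 2 F hcpt, π.1.IsLAlgebraic ∧ ∀ᶠ v in cofinite, Summit.Langlands.SatakeFrobCompatibleAt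 ι π.1 ρ v

/-! ### Layer-2 stubs of the special cells and the dictionary (support statements; two are LANDED conditional theorems of the tree) -/

/-- OBC-1 · **Skinner–Wiles over ℚ, untwisted** (print: SkinnerWiles1999 §1 Theorem p. 6 [ℚ, residually reducible, (i) p-distinguished,
(ii) ordinary, (iii) det = ψε^{k-1} odd]; SkinnerWiles2001 Thm [ℚ, residually irreducible nearly ordinary distinguished]; Deligne–Carayol for the
newform's π): for `ρ` in the sector with `ρ = ν ⊗ ρ'|_{Γ_F}`, `ρ'` odd, `ν` of finite order, the descended `ρ'` is Satake–Frobenius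
compatible with a cuspidal `π` on `GL₂(𝔸_ℚ)` of regular L-algebraic infinity type.  Why it might fail: only as typed — `ρ'` need not be
ordinary at `p` in SW's normalisation before a finite-order twist (absorbed: modularity is twist-stable), and SW01's residual-image proviso at
`p = 3`. -/
def OddDescentClassicalOverQ : Prop :=
  ∀ (F : Type) [Field F] [NumberField F], NumberField.IsTotallyComplex F → Module.finrank ℚ F = 2 → ∀ (p : ℕ) [Fact p.Prime], p ≠ 2 → ∀ (O : ValuationSubring (PadicAlgCl p)), O = (Valued.v : Valuation (PadicAlgCl p) NNReal).valuationSubring → ∀ (ι : PadicAlgCl p ≃+* ℂ) (ρ : Literature.NumberTheory.GaloisRepresentations.FramedGaloisRep F (PadicAlgCl p) 2) (ρ₀ : Field.absoluteGaloisGroup F →* Matrix.GeneralLinearGroup (Fin 2) O), ρ.toGaloisRep.IsIrreducible → (∀ᶠ v in cofinite, ρ.IsUnramifiedAt v) → ρ.HasUpperTriangularIntegralModel ρ₀ → (∃ k : ℕ, 2 ≤ k ∧ ∃ m : ℕ, 0 < m ∧ ∀ v : IsDedekindDomain.HeightOneSpectrum (NumberField.RingOfIntegers F), (p : NumberField.RingOfIntegers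 F) ∈ v.asIdeal → Literature.NumberTheory.GaloisRepresentations.IsPDistinguishedAt ρ₀ v ∧ ∃ Q : Matrix.GeneralLinearGroup (Fin 2) (PadicAlgCl p), Valued.v (Q.val 0 0) ≤ Valued.v (Q.val 1 0) ∧ ∀ σ, (Q⁻¹ * ρ.toLocal v σ * Q).val 1 0 = 0 ∧ (σ ∈ Literature.NumberTheory.GaloisRepresentations.absInertia (v.adicCompletion F) → (Q⁻¹ * ρ.toLocal v σ * Q).val 1 1 ^ m = 1 ∧ (Q⁻¹ * ρ.toLocal v σ * Q).val 0 0 ^ m = algebraMap (Padic p) (PadicAlgCl p) (((Literature.NumberTheory.GaloisRepresentations.GaloisRep.cyclotomicCharacter (v.adicCompletion F) p σ).val : PadicInt p) : Padic p) ^ ((k - 1) * m))) → ¬ (∃ (η : Field.absoluteGaloisGroup F →ₜ* (PadicAlgCl p)ˣ) (P : Matrix.GeneralLinearGroup (Fin 2) (PadicAlgCl p)), (∃ σ : Field.absoluteGaloisGroup F, η σ ≠ 1) ∧ ∀ σ : Field.absoluteGaloisGroup F, ((η σ : (PadicAlgCl p)ˣ) : PadicAlgCl p) • (ρ σ).val =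 (P * ρ σ * P⁻¹).val) → ∀ (ρ' : Literature.NumberTheory.GaloisRepresentations.FramedGaloisRep ℚ (PadicAlgCl p) 2) (ν : Field.absoluteGaloisGroup F →ₜ* (PadicAlgCl p)ˣ), ρ'.IsOdd → (∃ n : ℕ, 0 < n ∧ ∀ σ, ν σ ^ n = 1) → (∀ σ : Field.absoluteGaloisGroup F, (ρ σ).val = ((ν σ : (PadicAlgCl p)ˣ) : PadicAlgCl p) • (ρ' (Literature.NumberTheory.GaloisRepresentations.absGaloisRestrict ℚ F σ)).val) → ∀ (hcptQ : Literature.NumberTheory.Automorphic.isCompact_glFiniteIntegralLevel 2 ℚ), ∃ (π : Literature.NumberTheory.Automorphic.CuspidalAutomorphicRepData 2 ℚ hcptQ) (T : Literature.NumberTheory.Automorphic.InfinityType ℚ 2), π.1.HasInfinityType T ∧ T.IsLAlgebraic ∧ T.IsRegular ∧ ∀ᶠ w in cofinite, Summit.Langlands.SatakeFrobCompatibleAt ι π.1 ρ' w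

/-- OBC-2 · a finite-order continuous `p`-adic character of `Γ_F` kills the inertia groups at almost every place (open kernel ⟹ finite
Galois splitting field ⟹ unramified outside its discriminant).  (folklore; M-sized; a node STUB statement, kept in this twin — not a Literature fact) -/
def FiniteOrderCharacterUnramifiedAE : Prop :=
  ∀ (F : Type) [Field F] [NumberField F] (p : ℕ) [Fact p.Prime] (ν : Field.absoluteGaloisGroup F →ₜ* (PadicAlgCl p)ˣ), (∃ n : ℕ, 0 < n ∧ ∀ σ, ν σ ^ n = 1) → ∀ᶠ v : IsDedekindDomain.HeightOneSpectrum (NumberField.RingOfIntegers F) in Filter.cofinite, ∀ 𝔓 ∈ v.primesAbove, ∀ σ ∈ 𝔓.inertia (Field.absoluteGaloisGroup F), ν σ = 1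

/-- OBC-3 · **quadratic base change + finite-order twist, Satake–Frobenius compatible off `S`** — VERBATIM the conclusion of the tree's
conditional theorem `Theorems.SkinnerWilesDefectOne.EisensteinProModularSeed.stub_quadraticBaseChangeTwist` (LANDED; its three named facts
`baseChange_cyclic_cuspidal`, `ArthurClozel1989_strongLifting_archimedean`, `Langlands1980_quadraticBaseChange_frobCompatible` are print:
Langlands 1980, Arthur–Clozel Thm 4.2(a)/5.1, Carayol 1986) — kernel `quadraticBaseChangeTwistTransport_of_facts`. -/
def QuadraticBaseChangeTwistTransport : Prop :=
  ∀ (F : Type) [Field F] [NumberField F], NumberField.IsTotallyComplex F → Module.finrank ℚ F = 2 → ∀ (p : ℕ) [Fact p.Prime] (hcptQ : Literature.NumberTheory.Automorphic.isCompact_glFiniteIntegralLevel 2 ℚ) (ι : PadicAlgCl p ≃+* ℂ) (π : Literature.NumberTheory.Automorphic.CuspidalAutomorphicRepData 2 ℚ hcptQ) (T : Literature.NumberTheory.Automorphic.InfinityType ℚ 2), π.1.HasInfinityType T → T.IsLAlgebraic → T.IsRegular → ∀ (ρ' : Literature.NumberTheory.GaloisRepresentations.FramedGaloisRep ℚ (PadicAlgCl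 p) 2), (∀ᶠ w in Filter.cofinite, Summit.Langlands.SatakeFrobCompatibleAt ι π.1 ρ' w) → ∀ (ν : Field.absoluteGaloisGroup F →ₜ* (PadicAlgCl p)ˣ), (∃ n : ℕ, 0 < n ∧ ∀ σ, ν σ ^ n = 1) → ∀ (r : Literature.NumberTheory.GaloisRepresentations.FramedGaloisRep F (PadicAlgCl p) 2), (∀ σ, (r σ).val = ((ν σ : (PadicAlgCl p)ˣ) : PadicAlgCl p) • (ρ' (Literature.NumberTheory.GaloisRepresentations.absGaloisRestrict ℚ F σ)).val) → r.toGaloisRep.IsIrreducible → ∀ (S : Set (IsDedekindDomain.HeightOneSpectrum (NumberField.RingOfIntegers F))), S.Finite → (∀ v : IsDedekindDomain.HeightOneSpectrum (NumberField.RingOfIntegers F), (p : NumberField.RingOfIntegers F) ∈ v.asIdeal → v ∈ S) → (∀ v ∉ S, r.IsUnramifiedAt v) → (∀ v ∉ S, ∀ 𝔓 ∈ v.primesAbove, ∀ σ ∈ 𝔓.inertia (Field.absoluteGaloisGroup F), ν σ = 1) → ∀ hcptF : Literature.NumberTheory.Automorphic.isCompact_glFiniteIntegralLevel 2 F, ∃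 (πF : Literature.NumberTheory.Automorphic.CuspidalAutomorphicRepData 2 F hcptF) (T' : Literature.NumberTheory.Automorphic.InfinityType F 2), πF.1.HasInfinityType T' ∧ T'.IsLAlgebraic ∧ T'.IsRegular ∧ ∀ v ∉ S, Summit.Langlands.SatakeFrobCompatibleAt ι πF.1 r v

/-- CM-1 · **Galois side of the CM cell**: a self-twisted `ρ` of the sector is, at almost every place, Frobenius-compatible with the
induction of an ALGEBRAIC, F-regular Hecke character `θ` of a quadratic `K/F` (Clifford: `ρ ≅ Ind_K^F χ` with `K` cut out by the quadratic
`η`; ordinary of weight `k ≥ 2` ⟹ Hodge–Tate ⟹ `χ` locally algebraic ⟹ `θ` algebraic (Serre, Weil); `χ ≠ χ^c` since `ρ` is irreducible).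
Print, Galois-theoretic, M/L-sized. -/
def SelfTwistInducedCharacter : Prop :=
  ∀ (F : Type) [Field F] [NumberField F], NumberField.IsTotallyComplex F → Module.finrank ℚ F = 2 → ∀ (p : ℕ) [Fact p.Prime], p ≠ 2 → ∀ (O : ValuationSubring (PadicAlgCl p)), O = (Valued.v : Valuation (PadicAlgCl p) NNReal).valuationSubring → ∀ (ι : PadicAlgCl p ≃+* ℂ) (ρ : Literature.NumberTheory.GaloisRepresentations.FramedGaloisRep F (PadicAlgCl p) 2) (ρ₀ : Field.absoluteGaloisGroup F →* Matrix.GeneralLinearGroup (Fin 2) O), ρ.toGaloisRep.IsIrreducible → (∀ᶠ v in cofinite, ρ.IsUnramifiedAt v) → ρ.HasUpperTriangularIntegralModel ρ₀ → (∃ k : ℕ, 2 ≤ k ∧ ∃ m : ℕ, 0 < m ∧ ∀ v : IsDedekindDomain.HeightOneSpectrum (NumberField.RingOfIntegers F), (p : NumberField.RingOfIntegers F) ∈ v.asIdeal → Literature.NumberTheory.GaloisRepresentations.IsPDistinguishedAt ρ₀ v ∧ ∃ Q : Matrix.GeneralLinearGroup (Fin 2) (PadicAlgCl p), Valued.v (Q.val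 0 0) ≤ Valued.v (Q.val 1 0) ∧ ∀ σ, (Q⁻¹ * ρ.toLocal v σ * Q).val 1 0 = 0 ∧ (σ ∈ Literature.NumberTheory.GaloisRepresentations.absInertia (v.adicCompletion F) → (Q⁻¹ * ρ.toLocal v σ * Q).val 1 1 ^ m = 1 ∧ (Q⁻¹ * ρ.toLocal v σ * Q).val 0 0 ^ m = algebraMap (Padic p) (PadicAlgCl p) (((Literature.NumberTheory.GaloisRepresentations.GaloisRep.cyclotomicCharacter (v.adicCompletion F) p σ).val : PadicInt p) : Padic p) ^ ((k - 1) * m))) → (∃ (η : Field.absoluteGaloisGroup F →ₜ* (PadicAlgCl p)ˣ) (P : Matrix.GeneralLinearGroup (Fin 2) (PadicAlgCl p)), (∃ σ : Field.absoluteGaloisGroup F, η σ ≠ 1) ∧ ∀ σ : Field.absoluteGaloisGroup F, ((η σ : (PadicAlgCl p)ˣ) : PadicAlgCl p) • (ρ σ).val = (P * ρ σ * P⁻¹).val) → ∃ (K : Type) (_ : Field K) (_ : NumberField K) (_ : Algebra F K), Module.finrank F K = 2 ∧ ∃ θ : Literature.NumberTheory.GaloisRepresentations.HeckeCharacter K,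 θ.IsAlgebraic ∧ (∃ᶠ w : IsDedekindDomain.HeightOneSpectrum (NumberField.RingOfIntegers K) in Filter.cofinite, ∃ w' : IsDedekindDomain.HeightOneSpectrum (NumberField.RingOfIntegers K), w'.asIdeal.under (NumberField.RingOfIntegers F) = w.asIdeal.under (NumberField.RingOfIntegers F) ∧ θ.valueAtUniformizer w' ≠ θ.valueAtUniformizer w) ∧ (∀ᶠ v : IsDedekindDomain.HeightOneSpectrum (NumberField.RingOfIntegers F) in Filter.cofinite, ρ.IsUnramifiedAt v ∧ ρ.HasFrobCharpolyAt v (∏ᶠ w ∈ {w : IsDedekindDomain.HeightOneSpectrum (NumberField.RingOfIntegers K) | w.under (NumberField.RingOfIntegers F) = v}, (Polynomial.X ^ w.asIdeal.inertiaDeg (NumberField.RingOfIntegers F) - Polynomial.C (ι.symm (θ.valueAtUniformizer w)⁻¹))))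

/-- CM-2 · **automorphic induction GL₁/K → GL₂/F of an algebraic regular Hecke character, cuspidal and L-algebraic** — VERBATIM the conclusion
of the tree's conditional theorem `Cruxes.ProModularOrdinaryClassical.TopDegreeExactControl.stub_cmInducedCuspidal` (LANDED; facts A–C print:
Arthur–Clozel Thm 6.2, Henniart 2012, Clozel 1990 §3.3) — kernel `cmInducedCuspidal_of_facts`. -/
def CMInducedCuspidal : Prop :=
  ∀ (F : Type) [Field F] [NumberField F] (hcpt : Literature.NumberTheory.Automorphic.isCompact_glFiniteIntegralLevel 2 F) (K : Type) [Field K] [NumberField K] [Algebra F K], Module.finrank F K = 2 → ∀ (θ : Literature.NumberTheory.GaloisRepresentations.HeckeCharacter K), θ.IsAlgebraic → (∃ᶠ w : IsDedekindDomain.HeightOneSpectrum (NumberField.RingOfIntegers K) in Filter.cofinite, ∃ w' : IsDedekindDomain.HeightOneSpectrum (NumberField.RingOfIntegers K), w'.asIdeal.under (NumberField.RingOfIntegers F) = w.asIdeal.under (NumberField.RingOfIntegers F) ∧ θ.valueAtUniformizer w' ≠ θ.valueAtUniformizer w) → ∃ π : Literature.NumberTheory.Automorphic.CuspidalAutomorphicRepData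 2 F hcpt, π.1.IsLAlgebraic ∧ ∀ᶠ v : IsDedekindDomain.HeightOneSpectrum (NumberField.RingOfIntegers F) in Filter.cofinite, ∃ α : Multiset ℂ, π.1.HasSatakeParamAt v α ∧ Literature.NumberTheory.Automorphic.satakePolynomial α = ∏ᶠ w ∈ {w : IsDedekindDomain.HeightOneSpectrum (NumberField.RingOfIntegers K) | w.under (NumberField.RingOfIntegers F) = v}, (Polynomial.X ^ w.asIdeal.inertiaDeg (NumberField.RingOfIntegers F) - Polynomial.C (θ.valueAtUniformizer w))

/-- DICT · **the EXIT CONVERSE** (support; print): a classically automorphic (L-algebraic cuspidal, Satake–Frobenius compatible a.e.)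
irreducible `ρ` which is ordinary of a parallel weight `k ≥ 2` above `p` is `p`-adically automorphic of some tame level — the host's EXIT
`ProModularOrdinaryClassical` with hypothesis and conclusion swapped (Eichler–Shimura–Harder: the regular-algebraic cuspidal `π` is cohomological
in weight `(k,k)`; Emerton 2006 / Hida: classical cohomological eigensystems are points of the completed Hecke algebra `𝕋(𝒰)`). -/
def ClassicalOrdinaryProModular : Prop :=
  ∀ (F : Type) [Field F] [NumberField F], NumberField.IsTotallyComplex F → Module.finrank ℚ F = 2 → ∀ (p : ℕ) [Fact p.Prime], p ≠ 2 → ∀ (hcpt : Literature.NumberTheory.Automorphic.isCompact_glFiniteIntegralLevel 2 F) (ι : PadicAlgCl p ≃+* ℂ) (ρ : Literature.NumberTheory.GaloisRepresentations.FramedGaloisRep F (PadicAlgCl p) 2), ρ.toGaloisRep.IsIrreducible → (∀ᶠ v in cofinite, ρ.IsUnramifiedAt v) → (∃ k : ℕ, 2 ≤ k ∧ ∃ m : ℕ, 0 < m ∧ ∀ v : IsDedekindDomain.HeightOneSpectrum (NumberField.RingOfIntegers F), (p : NumberField.RingOfIntegers F) ∈ v.asIdeal → ρ.IsOrdinaryOfWeightAt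 p v k m) → (∃ π : Literature.NumberTheory.Automorphic.CuspidalAutomorphicRepData 2 F hcpt, π.1.IsLAlgebraic ∧ ∀ᶠ v in cofinite, Summit.Langlands.SatakeFrobCompatibleAt ι π.1 ρ v) → ∃ 𝒰 : Literature.NumberTheory.Automorphic.BigHeckeGLn.TameLevel 2 F p, 𝒰.IsPadicallyAutomorphic ρ

/-! ## §3 Text identities (kernel `Iff.rfl`): the items of record and the dial -/

/-- X of record: the TREE decl `SkinnerWilesDefectOne.ReducibleOrdinaryModular` unfolds to the text the cells restrict. -/
theorem target_text_iff : Summit.Langlands.Langlands.Theses.SkinnerWilesDefectOne.ReducibleOrdinaryModular ↔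
    (∀ (F : Type) [Field F] [NumberField F], NumberField.IsTotallyComplex F → Module.finrank ℚ F = 2 → ∀ (p : ℕ) [Fact p.Prime], p ≠ 2 → ∀ (O : ValuationSubring (PadicAlgCl p)), O = (Valued.v : Valuation (PadicAlgCl p) NNReal).valuationSubring → ∀ (hcpt : Literature.NumberTheory.Automorphic.isCompact_glFiniteIntegralLevel 2 F) (ι : PadicAlgCl p ≃+* ℂ) (ρ : Literature.NumberTheory.GaloisRepresentations.FramedGaloisRep F (PadicAlgCl p) 2) (ρ₀ : Field.absoluteGaloisGroup F →* Matrix.GeneralLinearGroup (Fin 2) O), ρ.toGaloisRep.IsIrreducible → (∀ᶠ v in cofinite, ρ.IsUnramifiedAt v) → ρ.HasUpperTriangularIntegralModel ρ₀ → (∃ k : ℕ, 2 ≤ k ∧ ∃ m : ℕ, 0 < m ∧ ∀ v : IsDedekindDomain.HeightOneSpectrum (NumberField.RingOfIntegers F), (p : NumberField.RingOfIntegers F) ∈ v.asIdeal → Literature.NumberTheory.GaloisRepresentations.IsPDistinguishedAt ρ₀ v ∧ ∃ Q : Matrix.GeneralLinearGroup (Fin 2) (PadicAlgCl p), Valued.v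 (Q.val 0 0) ≤ Valued.v (Q.val 1 0) ∧ ∀ σ, (Q⁻¹ * ρ.toLocal v σ * Q).val 1 0 = 0 ∧ (σ ∈ Literature.NumberTheory.GaloisRepresentations.absInertia (v.adicCompletion F) → (Q⁻¹ * ρ.toLocal v σ * Q).val 1 1 ^ m = 1 ∧ (Q⁻¹ * ρ.toLocal v σ * Q).val 0 0 ^ m = algebraMap (Padic p) (PadicAlgCl p) (((Literature.NumberTheory.GaloisRepresentations.GaloisRep.cyclotomicCharacter (v.adicCompletion F) p σ).val : PadicInt p) : Padic p) ^ ((k - 1) * m))) → ∃ π : Literature.NumberTheory.Automorphic.CuspidalAutomorphicRepData 2 F hcpt, π.1.IsLAlgebraic ∧ ∀ᶠ v in cofinite, Summit.Langlands.SatakeFrobCompatibleAt ι π.1 ρ v) := Iff.rfl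

/-- E of record: the TREE decl `SkinnerWilesDefectOne.ReducibleOrdinaryProModular`. -/
theorem engine_text_iff : Summit.Langlands.Langlands.Theses.SkinnerWilesDefectOne.ReducibleOrdinaryProModular ↔
    (∀ (F : Type) [Field F] [NumberField F], NumberField.IsTotallyComplex F → Module.finrank ℚ F = 2 → ∀ (p : ℕ) [Fact p.Prime], p ≠ 2 → ∀ (O : ValuationSubring (PadicAlgCl p)), O = (Valued.v : Valuation (PadicAlgCl p) NNReal).valuationSubring → ∀ (ρ : Literature.NumberTheory.GaloisRepresentations.FramedGaloisRep F (PadicAlgCl p) 2) (ρ₀ : Field.absoluteGaloisGroup F →* Matrix.GeneralLinearGroup (Fin 2) O), ρ.toGaloisRep.IsIrreducible → (∀ᶠ v in cofinite, ρ.IsUnramifiedAt v) → ρ.HasUpperTriangularIntegralModel ρ₀ → (∃ k : ℕ, 2 ≤ k ∧ ∃ m : ℕ, 0 < m ∧ ∀ v : IsDedekindDomain.HeightOneSpectrum (NumberField.RingOfIntegers F), (p : NumberField.RingOfIntegers F) ∈ v.asIdeal → Literature.NumberTheory.GaloisRepresentations.IsPDistinguishedAt ρ₀ v ∧ ∃ Q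 : Matrix.GeneralLinearGroup (Fin 2) (PadicAlgCl p), Valued.v (Q.val 0 0) ≤ Valued.v (Q.val 1 0) ∧ ∀ σ, (Q⁻¹ * ρ.toLocal v σ * Q).val 1 0 = 0 ∧ (σ ∈ Literature.NumberTheory.GaloisRepresentations.absInertia (v.adicCompletion F) → (Q⁻¹ * ρ.toLocal v σ * Q).val 1 1 ^ m = 1 ∧ (Q⁻¹ * ρ.toLocal v σ * Q).val 0 0 ^ m = algebraMap (Padic p) (PadicAlgCl p) (((Literature.NumberTheory.GaloisRepresentations.GaloisRep.cyclotomicCharacter (v.adicCompletion F) p σ).val : PadicInt p) : Padic p) ^ ((k - 1) * m))) → ∃ 𝒰 : Literature.NumberTheory.Automorphic.BigHeckeGLn.TameLevel 2 F p, 𝒰.IsPadicallyAutomorphic ρ) := Iff.rfl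

/-- EXIT of record: the TREE decl `SkinnerWilesDefectOne.ProModularOrdinaryClassical`. -/
theorem exit_text_iff : Summit.Langlands.Langlands.Theses.SkinnerWilesDefectOne.ProModularOrdinaryClassical ↔
    (∀ (F : Type) [Field F] [NumberField F], NumberField.IsTotallyComplex F → Module.finrank ℚ F = 2 → ∀ (p : ℕ) [Fact p.Prime], p ≠ 2 → ∀ (hcpt : Literature.NumberTheory.Automorphic.isCompact_glFiniteIntegralLevel 2 F) (ι : PadicAlgCl p ≃+* ℂ) (ρ : Literature.NumberTheory.GaloisRepresentations.FramedGaloisRep F (PadicAlgCl p) 2), ρ.toGaloisRep.IsIrreducible → (∀ᶠ v in cofinite, ρ.IsUnramifiedAt v) → (∃ 𝒰 : Literature.NumberTheory.Automorphic.BigHeckeGLn.TameLevel 2 F p, 𝒰.IsPadicallyAutomorphic ρ) → (∃ k : ℕ, 2 ≤ k ∧ ∃ m : ℕ, 0 < m ∧ ∀ v : IsDedekindDomain.HeightOneSpectrum (NumberField.RingOfIntegers F), (p : NumberField.RingOfIntegers F) ∈ v.asIdeal → ρ.IsOrdinaryOfWeightAt p v k m) → ∃ π : Literature.NumberTheory.Automorphic.CuspidalAutomorphicRepData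 2 F hcpt, π.1.IsLAlgebraic ∧ ∀ᶠ v in cofinite, Summit.Langlands.SatakeFrobCompatibleAt ι π.1 ρ v) := Iff.rfl

section DialText
variable (F : Type) [Field F] [NumberField F] (p : ℕ) [Fact p.Prime] (ρ : FramedGaloisRep F (PadicAlgCl p) 2)
omit [NumberField F] in
/-- the inlined self-twist text = `IsSelfTwist`. -/
theorem selfTwist_iff_text : IsSelfTwist F p ρ ↔ (∃ (η : Field.absoluteGaloisGroup F →ₜ* (PadicAlgCl p)ˣ) (P : Matrix.GeneralLinearGroup (Fin 2) (PadicAlgCl p)), (∃ σ : Field.absoluteGaloisGroup F, η σ ≠ 1) ∧ ∀ σ : Field.absoluteGaloisGroup F, ((η σ : (PadicAlgCl p)ˣ) : PadicAlgCl p) • (ρ σ).val = (P * ρ σ * P⁻¹).val) := Iff.rfl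
/-- the inlined odd-descent text = `IsOddDescent`. -/
theorem oddDescent_iff_text : IsOddDescent F p ρ ↔ (∃ (ρ' : Literature.NumberTheory.GaloisRepresentations.FramedGaloisRep ℚ (PadicAlgCl p) 2) (ν : Field.absoluteGaloisGroup F →ₜ* (PadicAlgCl p)ˣ), ρ'.IsOdd ∧ (∃ n : ℕ, 0 < n ∧ ∀ σ, ν σ ^ n = 1) ∧ ∀ σ : Field.absoluteGaloisGroup F, (ρ σ).val = ((ν σ : (PadicAlgCl p)ˣ) : PadicAlgCl p) • (ρ' (Literature.NumberTheory.GaloisRepresentations.absGaloisRestrict ℚ F σ)).val) := Iff.rfl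
/-- the inlined even-descent text = `IsEvenDescent`. -/
theorem evenDescent_iff_text : IsEvenDescent F p ρ ↔ (∃ (ρ' : Literature.NumberTheory.GaloisRepresentations.FramedGaloisRep ℚ (PadicAlgCl p) 2) (ν : Field.absoluteGaloisGroup F →ₜ* (PadicAlgCl p)ˣ), ¬ ρ'.IsOdd ∧ (∃ n : ℕ, 0 < n ∧ ∀ σ, ν σ ^ n = 1) ∧ ∀ σ : Field.absoluteGaloisGroup F, (ρ σ).val = ((ν σ : (PadicAlgCl p)ˣ) : PadicAlgCl p) • (ρ' (Literature.NumberTheory.GaloisRepresentations.absGaloisRestrict ℚ F σ)).val) := Iff.rfl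
end DialText

/-- DICT is literally the EXIT with its last two arrows swapped (structured reading). -/
theorem classicalOrdinaryProModular_iff : ClassicalOrdinaryProModular ↔
    (∀ (F : Type) [Field F] [NumberField F], NumberField.IsTotallyComplex F → Module.finrank ℚ F = 2 → ∀ (p : ℕ) [Fact p.Prime], p ≠ 2 →
      ∀ (hcpt : isCompact_glFiniteIntegralLevel 2 F) (ι : PadicAlgCl p ≃+* ℂ) (ρ : FramedGaloisRep F (PadicAlgCl p) 2),
      ρ.toGaloisRep.IsIrreducible → (∀ᶠ v in cofinite, ρ.IsUnramifiedAt v) →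
      (∃ k : ℕ, 2 ≤ k ∧ ∃ m : ℕ, 0 < m ∧ ∀ v : HeightOneSpectrum (𝓞 F), (p : 𝓞 F) ∈ v.asIdeal → ρ.IsOrdinaryOfWeightAt p v k m) →
      (∃ π : Literature.NumberTheory.Automorphic.CuspidalAutomorphicRepData 2 F hcpt, π.1.IsLAlgebraic ∧ ∀ᶠ v in cofinite, Summit.Langlands.SatakeFrobCompatibleAt ι π.1 ρ v) → ∃ 𝒰 : Literature.NumberTheory.Automorphic.BigHeckeGLn.TameLevel 2 F p, 𝒰.IsPadicallyAutomorphic ρ) := Iff.rfl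

/-! ## §4 Kernels -/

/-! ### Exactness at both levels (mod nothing) and the deciding theorems -/

/-- **V-R(X) deciding theorem**: the three X-cells give the host TARGET `ReducibleOrdinaryModular` BY NAME (two excluded middles on the dial). -/
theorem closes_target (h₁ : CMModular) (h₂ : OddDescentModular) (h₃ : GenericModular) :
    Summit.Langlands.Langlands.Theses.SkinnerWilesDefectOne.ReducibleOrdinaryModular := by
  intro F _ _ hF hdeg p _ hp O hO hcpt ι ρ ρ₀ hirr hunr hmod hord
  by_cases hst : (∃ (η : Field.absoluteGaloisGroup F →ₜ* (PadicAlgCl p)ˣ) (P : Matrix.GeneralLinearGroup (Fin 2) (PadicAlgCl p)), (∃ σ : Field.absoluteGaloisGroup F, η σ ≠ 1) ∧ ∀ σ : Field.absoluteGaloisGroup F, ((η σ : (PadicAlgCl p)ˣ) : PadicAlgCl p) • (ρ σ).val = (P * ρ σ * P⁻¹).val)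
  · exact h₁ F hF hdeg p hp O hO hcpt ι ρ ρ₀ hirr hunr hmod hord hst
  · by_cases hobc : (∃ (ρ' : Literature.NumberTheory.GaloisRepresentations.FramedGaloisRep ℚ (PadicAlgCl p) 2) (ν : Field.absoluteGaloisGroup F →ₜ* (PadicAlgCl p)ˣ), ρ'.IsOdd ∧ (∃ n : ℕ, 0 < n ∧ ∀ σ, ν σ ^ n = 1) ∧ ∀ σ : Field.absoluteGaloisGroup F, (ρ σ).val = ((ν σ : (PadicAlgCl p)ˣ) : PadicAlgCl p) • (ρ' (Literature.NumberTheory.GaloisRepresentations.absGaloisRestrict ℚ F σ)).val)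
    · exact h₂ F hF hdeg p hp O hO hcpt ι ρ ρ₀ hirr hunr hmod hord hst hobc
    · exact h₃ F hF hdeg p hp O hO hcpt ι ρ ρ₀ hirr hunr hmod hord hst hobc

/-- **V-R(E) deciding theorem**: the three E-cells give the host ENGINE `ReducibleOrdinaryProModular` BY NAME. -/
theorem closes_engine (h₁ : CMProModular) (h₂ : OddDescentProModular) (h₃ : GenericProModular) :
    Summit.Langlands.Langlands.Theses.SkinnerWilesDefectOne.ReducibleOrdinaryProModular := by
  intro F _ _ hF hdeg p _ hp O hO ρ ρ₀ hirr hunr hmod hord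
  by_cases hst : (∃ (η : Field.absoluteGaloisGroup F →ₜ* (PadicAlgCl p)ˣ) (P : Matrix.GeneralLinearGroup (Fin 2) (PadicAlgCl p)), (∃ σ : Field.absoluteGaloisGroup F, η σ ≠ 1) ∧ ∀ σ : Field.absoluteGaloisGroup F, ((η σ : (PadicAlgCl p)ˣ) : PadicAlgCl p) • (ρ σ).val = (P * ρ σ * P⁻¹).val)
  · exact h₁ F hF hdeg p hp O hO ρ ρ₀ hirr hunr hmod hord hst
  · by_cases hobc : (∃ (ρ' : Literature.NumberTheory.GaloisRepresentations.FramedGaloisRep ℚ (PadicAlgCl p) 2) (ν : Field.absoluteGaloisGroup F →ₜ* (PadicAlgCl p)ˣ), ρ'.IsOdd ∧ (∃ n : ℕ, 0 < n ∧ ∀ σ, ν σ ^ n = 1) ∧ ∀ σ : Field.absoluteGaloisGroup F, (ρ σ).val = ((ν σ : (PadicAlgCl p)ˣ) : PadicAlgCl p) • (ρ' (Literature.NumberTheory.GaloisRepresentations.absGaloisRestrict ℚ F σ)).val)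
    · exact h₂ F hF hdeg p hp O hO ρ ρ₀ hirr hunr hmod hord hst hobc
    · exact h₃ F hF hdeg p hp O hO ρ ρ₀ hirr hunr hmod hord hst hobc

/-- necessity: X ⟹ the CM cell (forget the sector hypothesis). -/
theorem cmModular_of_target (h : Summit.Langlands.Langlands.Theses.SkinnerWilesDefectOne.ReducibleOrdinaryModular) : CMModular :=
  fun F _ _ hF hdeg p _ hp O hO hcpt ι ρ ρ₀ hirr hunr hmod hord _ => h F hF hdeg p hp O hO hcpt ι ρ ρ₀ hirr hunr hmod hord
/-- necessity: X ⟹ the odd-descent cell. -/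
theorem oddDescentModular_of_target (h : Summit.Langlands.Langlands.Theses.SkinnerWilesDefectOne.ReducibleOrdinaryModular) : OddDescentModular :=
  fun F _ _ hF hdeg p _ hp O hO hcpt ι ρ ρ₀ hirr hunr hmod hord _ _ => h F hF hdeg p hp O hO hcpt ι ρ ρ₀ hirr hunr hmod hord
/-- necessity: X ⟹ the generic cell. -/
theorem genericModular_of_target (h : Summit.Langlands.Langlands.Theses.SkinnerWilesDefectOne.ReducibleOrdinaryModular) : GenericModular :=
  fun F _ _ hF hdeg p _ hp O hO hcpt ι ρ ρ₀ hirr hunr hmod hord _ _ => h F hF hdeg p hp O hO hcpt ι ρ ρ₀ hirr hunr hmod hord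
/-- necessity: E ⟹ the CM engine cell. -/
theorem cmProModular_of_engine (h : Summit.Langlands.Langlands.Theses.SkinnerWilesDefectOne.ReducibleOrdinaryProModular) : CMProModular :=
  fun F _ _ hF hdeg p _ hp O hO ρ ρ₀ hirr hunr hmod hord _ => h F hF hdeg p hp O hO ρ ρ₀ hirr hunr hmod hord
/-- necessity: E ⟹ the odd-descent engine cell. -/
theorem oddDescentProModular_of_engine (h : Summit.Langlands.Langlands.Theses.SkinnerWilesDefectOne.ReducibleOrdinaryProModular) :
    OddDescentProModular :=
  fun F _ _ hF hdeg p _ hp O hO ρ ρ₀ hirr hunr hmod hord _ _ => h F hF hdeg p hp O hO ρ ρ₀ hirr hunr hmod hord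
/-- necessity: E ⟹ the generic engine cell. -/
theorem genericProModular_of_engine (h : Summit.Langlands.Langlands.Theses.SkinnerWilesDefectOne.ReducibleOrdinaryProModular) :
    GenericProModular :=
  fun F _ _ hF hdeg p _ hp O hO ρ ρ₀ hirr hunr hmod hord _ _ => h F hF hdeg p hp O hO ρ ρ₀ hirr hunr hmod hord

/-- **EXACTNESS (X-level), mod nothing**: X ⟺ CM ∧ OBC ∧ GEN cells. -/
theorem target_iff_cells : Summit.Langlands.Langlands.Theses.SkinnerWilesDefectOne.ReducibleOrdinaryModular ↔
    CMModular ∧ OddDescentModular ∧ GenericModular :=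
  ⟨fun h => ⟨cmModular_of_target h, oddDescentModular_of_target h, genericModular_of_target h⟩, fun h => closes_target h.1 h.2.1 h.2.2⟩

/-- **EXACTNESS (E-level), mod nothing**: E ⟺ CM ∧ OBC ∧ GEN engine cells. -/
theorem engine_iff_cells : Summit.Langlands.Langlands.Theses.SkinnerWilesDefectOne.ReducibleOrdinaryProModular ↔
    CMProModular ∧ OddDescentProModular ∧ GenericProModular :=
  ⟨fun h => ⟨cmProModular_of_engine h, oddDescentProModular_of_engine h, genericProModular_of_engine h⟩,
    fun h => closes_engine h.1 h.2.1 h.2.2⟩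

/-- **Root form (X-cells)**: the three X-cells and the host's declared residual `SectorComplement` give `_root_.Langlands` BY NAME. -/
theorem closes_root (h₁ : CMModular) (h₂ : OddDescentModular) (h₃ : GenericModular)
    (hC : Summit.Langlands.Langlands.Theses.SkinnerWilesDefectOne.SectorComplement) : _root_.Langlands :=
  hC (closes_target h₁ h₂ h₃)

/-- **Root form through the host**: the three E-cells feed the host's own `SkinnerWilesDefectOne.closes` (with its EXIT and residual). -/
theorem closes_via_host (h₁ : CMProModular) (h₂ : OddDescentProModular) (h₃ : GenericProModular)
    (hX : Summit.Langlands.Langlands.Theses.SkinnerWilesDefectOne.ProModularOrdinaryClassical)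
    (hC : Summit.Langlands.Langlands.Theses.SkinnerWilesDefectOne.SectorComplement) : _root_.Langlands :=
  Summit.Langlands.Langlands.Theses.SkinnerWilesDefectOne.closes (closes_engine h₁ h₂ h₃) hX hC

/-- the host's residual from the summit (as in the tree's `Theorems.skinnerWilesDefectOne_sectorComplement_of_langlands`, which lies outside
the farm's import cone — re-proved: `SectorComplement := X → Langlands`). -/
theorem sectorComplement_of_langlands (h : _root_.Langlands) : Summit.Langlands.Langlands.Theses.SkinnerWilesDefectOne.SectorComplement :=
  fun _ => h

/-! ### The level square: engine cell ∧ EXIT ⟹ target cell (the host's glue restricted); target cell ∧ DICT ⟹ engine cell -/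

/-- oriented-ordinary clause ⟹ `IsOrdinaryOfWeightAt` (the one line of the host's glue). -/
theorem ordinaryOfWeight_of_oriented {F : Type} [Field F] [NumberField F] {p : ℕ} [Fact p.Prime]
    (ρ : FramedGaloisRep F (PadicAlgCl p) 2) {O : ValuationSubring (PadicAlgCl p)}
    (ρ₀ : Field.absoluteGaloisGroup F →* Matrix.GeneralLinearGroup (Fin 2) O)
    (hord : (∃ k : ℕ, 2 ≤ k ∧ ∃ m : ℕ, 0 < m ∧ ∀ v : IsDedekindDomain.HeightOneSpectrum (NumberField.RingOfIntegers F), (p : NumberField.RingOfIntegers F) ∈ v.asIdeal → Literature.NumberTheory.GaloisRepresentations.IsPDistinguishedAt ρ₀ v ∧ ∃ Q : Matrix.GeneralLinearGroup (Fin 2) (PadicAlgCl p), Valued.v (Q.val 0 0) ≤ Valued.v (Q.val 1 0) ∧ ∀ σ, (Q⁻¹ * ρ.toLocal v σ * Q).val 1 0 = 0 ∧ (σ ∈ Literature.NumberTheory.GaloisRepresentations.absInertia (v.adicCompletion F) → (Q⁻¹ * ρ.toLocal v σ * Q).val 1 1 ^ m = 1 ∧ (Q⁻¹ * ρ.toLocal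 v σ * Q).val 0 0 ^ m = algebraMap (Padic p) (PadicAlgCl p) (((Literature.NumberTheory.GaloisRepresentations.GaloisRep.cyclotomicCharacter (v.adicCompletion F) p σ).val : PadicInt p) : Padic p) ^ ((k - 1) * m)))) :
    ∃ k : ℕ, 2 ≤ k ∧ ∃ m : ℕ, 0 < m ∧ ∀ v : HeightOneSpectrum (𝓞 F), (p : 𝓞 F) ∈ v.asIdeal → ρ.IsOrdinaryOfWeightAt p v k m := by
  obtain ⟨k, hk, m, hm, hv⟩ := hord
  refine ⟨k, hk, m, hm, fun v hpv => ?_⟩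
  obtain ⟨-, Q, -, hQ⟩ := hv v hpv
  exact (FramedGaloisRep.isOrdinaryOfWeightAt_iff_padicAlgCl p ρ v k m).mpr ⟨Q, hQ⟩

/-- **GEN: engine cell ∧ EXIT ⟹ target cell** — the host's blockers (12919, (OF)) are needed only on the generic stratum. -/
theorem genericModular_of_engine (hE : GenericProModular)
    (hX : Summit.Langlands.Langlands.Theses.SkinnerWilesDefectOne.ProModularOrdinaryClassical) : GenericModular := by
  intro F _ _ hF hdeg p _ hp O hO hcpt ι ρ ρ₀ hirr hunr hmod hord hst hobc
  exact hX F hF hdeg p hp hcpt ι ρ hirr hunr (hE F hF hdeg p hp O hO ρ ρ₀ hirr hunr hmod hord hst hobc) (ordinaryOfWeight_of_oriented ρ ρ₀ hord)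

/-- CM: engine cell ∧ EXIT ⟹ target cell. -/
theorem cmModular_of_engine (hE : CMProModular)
    (hX : Summit.Langlands.Langlands.Theses.SkinnerWilesDefectOne.ProModularOrdinaryClassical) : CMModular := by
  intro F _ _ hF hdeg p _ hp O hO hcpt ι ρ ρ₀ hirr hunr hmod hord hst
  exact hX F hF hdeg p hp hcpt ι ρ hirr hunr (hE F hF hdeg p hp O hO ρ ρ₀ hirr hunr hmod hord hst) (ordinaryOfWeight_of_oriented ρ ρ₀ hord)

/-- OBC: engine cell ∧ EXIT ⟹ target cell. -/
theorem oddDescentModular_of_engine (hE : OddDescentProModular)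
    (hX : Summit.Langlands.Langlands.Theses.SkinnerWilesDefectOne.ProModularOrdinaryClassical) : OddDescentModular := by
  intro F _ _ hF hdeg p _ hp O hO hcpt ι ρ ρ₀ hirr hunr hmod hord hst hobc
  exact hX F hF hdeg p hp hcpt ι ρ hirr hunr (hE F hF hdeg p hp O hO ρ ρ₀ hirr hunr hmod hord hst hobc) (ordinaryOfWeight_of_oriented ρ ρ₀ hord)

/-- **CM: target cell ∧ DICT ⟹ engine cell** (pick `hcpt` from the tree theorem `isCompact_glFiniteIntegralLevel_holds` and SOME
`ι : ℚ̄_p ≃ ℂ` from `PadicAlgCl.nonempty_ringEquiv_complex`). -/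
theorem cmProModular_of_classical (hX : CMModular) (hD : ClassicalOrdinaryProModular) : CMProModular := by
  intro F _ _ hF hdeg p _ hp O hO ρ ρ₀ hirr hunr hmod hord hst
  obtain ⟨ι⟩ := PadicAlgCl.nonempty_ringEquiv_complex p
  exact hD F hF hdeg p hp (isCompact_glFiniteIntegralLevel_holds 2 F) ι ρ hirr hunr (ordinaryOfWeight_of_oriented ρ ρ₀ hord)
    (hX F hF hdeg p hp O hO (isCompact_glFiniteIntegralLevel_holds 2 F) ι ρ ρ₀ hirr hunr hmod hord hst)

/-- OBC: target cell ∧ DICT ⟹ engine cell. -/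
theorem oddDescentProModular_of_classical (hX : OddDescentModular) (hD : ClassicalOrdinaryProModular) : OddDescentProModular := by
  intro F _ _ hF hdeg p _ hp O hO ρ ρ₀ hirr hunr hmod hord hst hobc
  obtain ⟨ι⟩ := PadicAlgCl.nonempty_ringEquiv_complex p
  exact hD F hF hdeg p hp (isCompact_glFiniteIntegralLevel_holds 2 F) ι ρ hirr hunr (ordinaryOfWeight_of_oriented ρ ρ₀ hord)
    (hX F hF hdeg p hp O hO (isCompact_glFiniteIntegralLevel_holds 2 F) ι ρ ρ₀ hirr hunr hmod hord hst hobc)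

/-- GEN: target cell ∧ DICT ⟹ engine cell. -/
theorem genericProModular_of_classical (hX : GenericModular) (hD : ClassicalOrdinaryProModular) : GenericProModular := by
  intro F _ _ hF hdeg p _ hp O hO ρ ρ₀ hirr hunr hmod hord hst hobc
  obtain ⟨ι⟩ := PadicAlgCl.nonempty_ringEquiv_complex p
  exact hD F hF hdeg p hp (isCompact_glFiniteIntegralLevel_holds 2 F) ι ρ hirr hunr (ordinaryOfWeight_of_oriented ρ ρ₀ hord)
    (hX F hF hdeg p hp O hO (isCompact_glFiniteIntegralLevel_holds 2 F) ι ρ ρ₀ hirr hunr hmod hord hst hobc)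

/-- Under DICT ∧ EXIT the two levels agree cellwise (×3). -/
theorem levels_agree (hD : ClassicalOrdinaryProModular) (hX : Summit.Langlands.Langlands.Theses.SkinnerWilesDefectOne.ProModularOrdinaryClassical) :
    (CMProModular ↔ CMModular) ∧ (OddDescentProModular ↔ OddDescentModular) ∧ (GenericProModular ↔ GenericModular) :=
  ⟨⟨fun h => cmModular_of_engine h hX, fun h => cmProModular_of_classical h hD⟩,
   ⟨fun h => oddDescentModular_of_engine h hX, fun h => oddDescentProModular_of_classical h hD⟩,
   ⟨fun h => genericModular_of_engine h hX, fun h => genericProModular_of_classical h hD⟩⟩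

/-- the host's target from the engine and the exit, through the cells (= closed item 14468 `ModularOfProModularClassical`, re-derived CELLWISE: each level-square edge, then `closes_target`). -/
theorem target_of_engine_exit (hE : Summit.Langlands.Langlands.Theses.SkinnerWilesDefectOne.ReducibleOrdinaryProModular)
    (hX : Summit.Langlands.Langlands.Theses.SkinnerWilesDefectOne.ProModularOrdinaryClassical) :
    Summit.Langlands.Langlands.Theses.SkinnerWilesDefectOne.ReducibleOrdinaryModular :=
  closes_target (cmModular_of_engine (cmProModular_of_engine hE) hX) (oddDescentModular_of_engine (oddDescentProModular_of_engine hE) hX)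
    (genericModular_of_engine (genericProModular_of_engine hE) hX)

/-! ### Layer 2 of the generic cells -/

/-- **GEN (E) from its parity boxes**: even-descent box and primitive box give the generic engine cell (excluded middle on even descent). -/
theorem genericProModular_of_parity (ha : EvenDescentProModular) (hb : PrimitiveProModular) : GenericProModular := by
  intro F _ _ hF hdeg p _ hp O hO ρ ρ₀ hirr hunr hmod hord hst hobc
  by_cases hev : (∃ (ρ' : Literature.NumberTheory.GaloisRepresentations.FramedGaloisRep ℚ (PadicAlgCl p) 2) (ν : Field.absoluteGaloisGroup F →ₜ* (PadicAlgCl p)ˣ), ¬ ρ'.IsOdd ∧ (∃ n : ℕ, 0 < n ∧ ∀ σ, ν σ ^ n = 1) ∧ ∀ σ : Field.absoluteGaloisGroup F, (ρ σ).val = ((ν σ : (PadicAlgCl p)ˣ) : PadicAlgCl p) • (ρ' (Literature.NumberTheory.GaloisRepresentations.absGaloisRestrict ℚ F σ)).val)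
  · exact ha F hF hdeg p hp O hO ρ ρ₀ hirr hunr hmod hord hst hobc hev
  · exact hb F hF hdeg p hp O hO ρ ρ₀ hirr hunr hmod hord hst hobc hev

/-- GEN (X) from its parity boxes. -/
theorem genericModular_of_parity (ha : EvenDescentModular) (hb : PrimitiveModular) : GenericModular := by
  intro F _ _ hF hdeg p _ hp O hO hcpt ι ρ ρ₀ hirr hunr hmod hord hst hobc
  by_cases hev : (∃ (ρ' : Literature.NumberTheory.GaloisRepresentations.FramedGaloisRep ℚ (PadicAlgCl p) 2) (ν : Field.absoluteGaloisGroup F →ₜ* (PadicAlgCl p)ˣ), ¬ ρ'.IsOdd ∧ (∃ n : ℕ, 0 < n ∧ ∀ σ, ν σ ^ n = 1) ∧ ∀ σ : Field.absoluteGaloisGroup F, (ρ σ).val = ((ν σ : (PadicAlgCl p)ˣ) : PadicAlgCl p) • (ρ' (Literature.NumberTheory.GaloisRepresentations.absGaloisRestrict ℚ F σ)).val)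
  · exact ha F hF hdeg p hp O hO hcpt ι ρ ρ₀ hirr hunr hmod hord hst hobc hev
  · exact hb F hF hdeg p hp O hO hcpt ι ρ ρ₀ hirr hunr hmod hord hst hobc hev

/-- the parity boxes from GEN (×2, E-level). -/
theorem parity_of_genericProModular (h : GenericProModular) : EvenDescentProModular ∧ PrimitiveProModular :=
  ⟨fun F _ _ hF hdeg p _ hp O hO ρ ρ₀ hirr hunr hmod hord hst hobc _ => h F hF hdeg p hp O hO ρ ρ₀ hirr hunr hmod hord hst hobc,
   fun F _ _ hF hdeg p _ hp O hO ρ ρ₀ hirr hunr hmod hord hst hobc _ => h F hF hdeg p hp O hO ρ ρ₀ hirr hunr hmod hord hst hobc⟩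

/-- GEN (E) ⟺ its two parity boxes. -/
theorem genericProModular_iff_parity : GenericProModular ↔ EvenDescentProModular ∧ PrimitiveProModular :=
  ⟨parity_of_genericProModular, fun h => genericProModular_of_parity h.1 h.2⟩

end Summit.Langlands.Langlands.Theorems.SkinnerWilesDefectOneSymmetryType
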